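import Mathlib.MeasureTheory.Integral.Lebesgue.Markov
import Literature.Analysis.SingularIntegrals.Marcinkiewicz
import Literature.Analysis.FunctionSpaces.LipschitzTruncation
import HarnessLib

/-!
# Gradient-dominated operators are bounded in `Ẇ^{1,p}`, `1 < p < 2`
(real interpolation of gradient bounds by Lipschitz truncation)

Let `T` map real test functions `u ∈ C^∞_c(E)` (finite-dimensional real normed space `E`,
additive Haar measure `μ`, `n = dim E`) to measurable functions with values in a normed group,
additively, with the two **gradient bounds**
`∫ ‖Tu‖ ≤ A₁ ∫ ‖Du‖` and `∫ ‖Tu‖² ≤ A₂ ∫ ‖Du‖²` ("gradient-dominated"). Then for `1 < p < 2`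
there is `K = K(n, p, A₁, A₂)` with `∫ ‖Tu‖ᵖ ≤ K ∫ ‖Du‖ᵖ`
(`exists_lintegral_rpow_le_of_gradientBounds`).

Proof (the real method made concrete, [Badr2009, Thm 5.5 / Cor. 5.9], [DeVoreScherer1979]
for `ℝⁿ`):

1. *Distribution-function inequality* (`meas_lt_enorm_le_of_gradientBounds`). Combine the
   smooth Lipschitz truncation
   (`Literature.Analysis.FunctionSpaces.exists_smooth_lipschitz_truncation`) of the mollified
   function `ρ_ε ⋆ u = g + b` at height `λ` with Chebyshev's inequality for `Tg` (in `L²`) and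
   `Tb` (in `L¹`), and let `ε → 0` through the `L²`-gradient bound applied to `u - ρ_ε ⋆ u`:
   `μ{λ < ‖Tu‖} ≤ (λ/4)⁻¹A₁ (2ⁿ ∫_{λ'<M} M + L μ{λ'<M}) + (λ/4)⁻²A₂ (2²ⁿ ∫_{M≤λ} M² + L² μ{λ'<M})`,
   `M = M(‖Du‖)` the centred maximal function, `λ' = λ/2ⁿ⁺¹`, `L = 2²ⁿ⁺⁶λ`.
2. *`λ`-integration* (`lintegral_rpow_le_of_meas_lt_le`): the layer-cake formula and the two
   Tonelli computations of the tree's Marcinkiewicz file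
   (`Literature.Analysis.SingularIntegrals.lintegral_rpow_mul_lintegral_indicator_lt/le`)
   give `∫ ‖Tu‖ᵖ ≲ ∫ Mᵖ`, and the maximal theorem
   (`Literature.Analysis.SingularIntegrals.lintegral_maximalFunction_rpow_le`) gives
   `∫ Mᵖ ≲ ∫ ‖Du‖ᵖ`.

## References

* [Badr2009] N. Badr, *Real interpolation of Sobolev spaces*, Math. Scand. 105 (2009), §5.
* [DeVoreScherer1979] R. DeVore, K. Scherer, *Interpolation of linear operators on Sobolev
  spaces*, Ann. of Math. 109 (1979) 583–599.
* [Stein1971] E. M. Stein, *Singular integrals and differentiability properties of functions*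
  (1970), Ch. I §4 (Marcinkiewicz computations).
-/

noncomputable section

open MeasureTheory Metric Set Filter Topology Module
open scoped ENNReal NNReal ContDiff

namespace Literature.Analysis.FunctionSpaces

open Literature.Analysis.SingularIntegrals

universe u

variable {E : Type u} [NormedAddCommGroup E] [NormedSpace ℝ E] [FiniteDimensional ℝ E]
  [MeasurableSpace E] [BorelSpace E] (μ : Measure E) [μ.IsAddHaarMeasure]
  {G : Type*} [NormedAddCommGroup G]

/-! ### Gradient-dominated operators

Throughout, `T : (E → ℝ) → E → G` is an operator on real test functions and the four hypotheses
`hadd` (additivity on `C^∞_c`), `hmeas` (a.e.-strong measurability of `Tu`), `hl1`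
(`∫ ‖Tu‖ ≤ A₁ ∫ ‖Du‖`) and `hl2` (`∫ ‖Tu‖² ≤ A₂ ∫ ‖Du‖²`) express that `T` is
**gradient-dominated** [cite: Badr2009, §5 (hypotheses of Thm 5.5, for an operator instead of
the K-functional)]. -/

/-! ### Chebyshev -/

/-- `μ{s < ‖f‖} ≤ s⁻¹ ∫ ‖f‖`. [folklore] -/
theorem meas_lt_enorm_le_lintegral {X : Type*} [MeasurableSpace X] {μ : Measure X} {f : X → G}
    (hf : AEStronglyMeasurable f μ) {s : ℝ≥0∞} (hs : s ≠ 0) (hs' : s ≠ ⊤) :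
    μ {x | s < ‖f x‖ₑ} ≤ s⁻¹ * ∫⁻ x, ‖f x‖ₑ ∂μ := by
  calc μ {x | s < ‖f x‖ₑ} ≤ μ {x | s ≤ ‖f x‖ₑ} :=
        measure_mono fun x (hx : s < ‖f x‖ₑ) => show s ≤ ‖f x‖ₑ from hx.le
    _ ≤ (∫⁻ x, ‖f x‖ₑ ∂μ) / s := meas_ge_le_lintegral_div hf.enorm hs hs'
    _ = s⁻¹ * ∫⁻ x, ‖f x‖ₑ ∂μ := by rw [div_eq_mul_inv, mul_comm]

/-- `μ{s < ‖f‖} ≤ s⁻² ∫ ‖f‖²`. [folklore] -/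
theorem meas_lt_enorm_le_lintegral_sq {X : Type*} [MeasurableSpace X] {μ : Measure X}
    {f : X → G} (hf : AEStronglyMeasurable f μ) {s : ℝ≥0∞} (hs : s ≠ 0) (hs' : s ≠ ⊤) :
    μ {x | s < ‖f x‖ₑ} ≤ (s ^ 2)⁻¹ * ∫⁻ x, ‖f x‖ₑ ^ 2 ∂μ := by
  calc μ {x | s < ‖f x‖ₑ} ≤ μ {x | s ^ 2 ≤ ‖f x‖ₑ ^ 2} :=
        measure_mono fun x (hx : s < ‖f x‖ₑ) =>
          show s ^ 2 ≤ ‖f x‖ₑ ^ 2 from pow_le_pow_left' hx.le 2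
    _ ≤ (∫⁻ x, ‖f x‖ₑ ^ 2 ∂μ) / s ^ 2 :=
        meas_ge_le_lintegral_div (hf.enorm.pow_const 2) (pow_ne_zero 2 hs)
          (ENNReal.pow_ne_top hs')
    _ = (s ^ 2)⁻¹ * ∫⁻ x, ‖f x‖ₑ ^ 2 ∂μ := by rw [div_eq_mul_inv, mul_comm]

/-- `{s < ‖a + b‖} ⊆ {s/2 < ‖a‖} ∪ {s/2 < ‖b‖}`. [folklore] -/
theorem setOf_lt_enorm_add_subset {X : Type*} (f g : X → G) (s : ℝ≥0∞) :
    {x | s < ‖f x + g x‖ₑ} ⊆ {x | s / 2 < ‖f x‖ₑ} ∪ {x | s / 2 < ‖g x‖ₑ} := by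
  intro x hx
  simp only [mem_setOf_eq, mem_union] at hx ⊢
  by_contra h
  simp only [not_or, not_lt] at h
  have : ‖f x + g x‖ₑ ≤ s / 2 + s / 2 := (enorm_add_le _ _).trans (add_le_add h.1 h.2)
  rw [ENNReal.add_halves] at this
  exact (hx.trans_le this).false

/-! ### Gradients of mollifications converge in `L²` -/

/-- For `u ∈ C¹_c` and `δ > 0`: `∫ ‖Du - D(ρ_ε ⋆ u)‖² ≤ δ` for all small `ε > 0`
(uniform continuity of `Du`, supports in a fixed compact set). [folklore] -/
theorem exists_lintegral_fderiv_sub_haarMollify_sq_le {u : E → ℝ} (hu : ContDiff ℝ 1 u)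
    (hcu : HasCompactSupport u) {δ : ℝ≥0∞} (hδ : 0 < δ) :
    ∃ ε₁ > 0, ∀ ε, 0 < ε → ε ≤ ε₁ →
      ∫⁻ x, ‖fderiv ℝ u x - fderiv ℝ (haarMollify μ ε u) x‖ₑ ^ 2 ∂μ ≤ δ := by
  have hDc : Continuous (fderiv ℝ u) := hu.continuous_fderiv one_ne_zero
  have hDu : UniformContinuous (fderiv ℝ u) :=
    (hcu.fderiv ℝ).uniformContinuous_of_continuous hDc
  -- the fixed compact set carrying all the gradients (for `ε ≤ 1/2`)
  set K := cthickening 1 (tsupport u) with hK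
  have hKc : IsCompact K := hcu.isCompact.cthickening
  have hKt : μ K < ⊤ := hKc.measure_lt_top
  -- choose `η` with `η² μ(K) ≤ δ`
  obtain ⟨η, hη, hηδ⟩ : ∃ η : ℝ, 0 < η ∧ ENNReal.ofReal (η ^ 2) * μ K ≤ δ := by
    rcases eq_or_ne (μ K) 0 with hK0 | hK0
    · exact ⟨1, one_pos, by simp [hK0]⟩
    rcases eq_or_ne δ ⊤ with rfl | hδt
    · exact ⟨1, one_pos, le_top⟩
    have hq : 0 < (δ / μ K).toReal := ENNReal.toReal_pos (ENNReal.div_pos hδ.ne' hKt.ne).ne'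
      (ENNReal.div_ne_top hδt hK0)
    refine ⟨Real.sqrt (δ / μ K).toReal, Real.sqrt_pos.2 hq, ?_⟩
    rw [Real.sq_sqrt hq.le, ENNReal.ofReal_toReal (ENNReal.div_ne_top hδt hK0),
      ENNReal.div_mul_cancel hK0 hKt.ne]
  obtain ⟨θ, hθ, hθη⟩ := Metric.uniformContinuous_iff.1 hDu η hη
  refine ⟨min (θ / 2) (1 / 2), by positivity, fun ε hε hεle => ?_⟩
  have hεθ : ε < θ := by linarith [min_le_left (θ / 2) (1 / 2)]
  have hε2 : 2 * ε ≤ 1 := by linarith [min_le_right (θ / 2) (1 / 2)]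
  -- pointwise bound `‖Du x - Du_ε x‖ ≤ η`, and `= 0` off `K`
  have hpt : ∀ x, ‖fderiv ℝ u x - fderiv ℝ (haarMollify μ ε u) x‖ₑ ^ 2 ≤
      K.indicator (fun _ => ENNReal.ofReal (η ^ 2)) x := by
    intro x
    by_cases hx : x ∈ K
    · rw [indicator_of_mem hx, ← ofReal_norm, ← ENNReal.ofReal_pow (norm_nonneg _)]
      refine ENNReal.ofReal_le_ofReal (pow_le_pow_left₀ (norm_nonneg _) ?_ 2)
      -- `‖Du x - Du_ε x‖ ≤ η` via `D(ρ_ε ⋆ u) v = ρ_ε ⋆ (Du · v)`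
      refine ContinuousLinearMap.opNorm_le_bound _ hη.le fun v => ?_
      rw [show (fderiv ℝ u x - fderiv ℝ (haarMollify μ ε u) x) v =
          fderiv ℝ u x v - fderiv ℝ (haarMollify μ ε u) x v from rfl,
        fderiv_haarMollify_apply μ ε hu hcu x v, ← dist_eq_norm, dist_comm]
      refine (haarBump ε).dist_normed_convolution_le
        (hDc.clm_apply continuous_const).aestronglyMeasurable
        fun y hy => ?_
      rw [haarBump_rOut hε] at hy
      rw [dist_eq_norm, show fderiv ℝ u y v - fderiv ℝ u x v = (fderiv ℝ u y - fderiv ℝ u x) v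
        from rfl]
      refine ((fderiv ℝ u y - fderiv ℝ u x).le_opNorm v).trans (mul_le_mul_of_nonneg_right ?_
        (norm_nonneg _))
      rw [← dist_eq_norm]
      exact (hθη ((mem_ball.1 hy).trans hεθ)).le
    · rw [indicator_of_notMem hx]
      -- off `K`, both gradients vanish: `u = 0` on `B(x, 2ε)`
      have hfar : ∀ y ∈ ball x (2 * ε), u y = 0 := by
        intro y hy
        refine image_eq_zero_of_notMem_tsupport fun hy' => hx ?_
        rw [hK, mem_cthickening_iff]
        refine (Metric.infEDist_le_edist_of_mem hy').trans ?_
        rw [edist_comm, edist_dist]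
        exact ENNReal.ofReal_le_ofReal ((mem_ball.1 hy).le.trans hε2)
      have h1 : fderiv ℝ (haarMollify μ ε u) x = 0 := by
        rw [fderiv_haarMollify_congr_ball μ hε (g := 0) (fun y hy => by rw [hfar y hy]; rfl)]
        simp [haarMollify, convolution_zero]
      have h2 : fderiv ℝ u x = 0 := by
        have : u =ᶠ[𝓝 x] fun _ => 0 := by
          filter_upwards [ball_mem_nhds x (by positivity : (0 : ℝ) < 2 * ε)] with y hy
          exact hfar y hy
        rw [this.fderiv_eq, fderiv_const_apply]
      rw [h1, h2, sub_zero, ← ofReal_norm, norm_zero, ENNReal.ofReal_zero, zero_pow two_ne_zero]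
  calc ∫⁻ x, ‖fderiv ℝ u x - fderiv ℝ (haarMollify μ ε u) x‖ₑ ^ 2 ∂μ
      ≤ ∫⁻ x, K.indicator (fun _ => ENNReal.ofReal (η ^ 2)) x ∂μ := lintegral_mono hpt
    _ = ENNReal.ofReal (η ^ 2) * μ K := by
        rw [lintegral_indicator hKc.isClosed.measurableSet, setLIntegral_const]
    _ ≤ δ := hηδ

/-! ### The distribution-function inequality -/

variable {μ}

omit [FiniteDimensional ℝ E] [MeasurableSpace E] [BorelSpace E] [μ.IsAddHaarMeasure] in
/-- `T(u) = T(v) + T(u - v)` for an additive `T`. [folklore] -/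
theorem apply_eq_add_sub_of_add {T : (E → ℝ) → E → G}
    (hadd : ∀ u v : E → ℝ, ContDiff ℝ ∞ u → HasCompactSupport u → ContDiff ℝ ∞ v →
      HasCompactSupport v → T (u + v) = T u + T v)
    {u v : E → ℝ} (hu : ContDiff ℝ ∞ u)
    (hcu : HasCompactSupport u) (hv : ContDiff ℝ ∞ v) (hcv : HasCompactSupport v) (x : E) :
    T u x = T v x + T (u - v) x := by
  have h := hadd v (u - v) hv hcv (hu.sub hv) (hcu.sub hcv)
  rw [add_sub_cancel] at h
  rw [h, Pi.add_apply]

/-- **The distribution-function inequality for gradient-dominated operators.** For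
`u ∈ C^∞_c`, `λ > 0`, `M = M(‖Du‖)`, `λ' = λ/2ⁿ⁺¹`, `L = 2²ⁿ⁺⁶λ`:
`μ{λ < ‖Tu‖} ≤ (λ/4)⁻¹ A₁ (2ⁿ ∫_{λ'<M} M + L μ{λ'<M}) + (λ/4)⁻² A₂ (2²ⁿ ∫_{M≤λ} M² + L² μ{λ'<M})`.
[cite: Badr2009, §5 proof of Thm 5.5 (good/bad part estimates)] -/
theorem meas_lt_enorm_le_of_gradientBounds {T : (E → ℝ) → E → G} {A₁ A₂ : ℝ≥0}
    (hadd : ∀ u v : E → ℝ, ContDiff ℝ ∞ u → HasCompactSupport u → ContDiff ℝ ∞ v →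
      HasCompactSupport v → T (u + v) = T u + T v)
    (hmeas : ∀ u : E → ℝ, ContDiff ℝ ∞ u → HasCompactSupport u → AEStronglyMeasurable (T u) μ)
    (hl1 : ∀ u : E → ℝ, ContDiff ℝ ∞ u → HasCompactSupport u →
      ∫⁻ x, ‖T u x‖ₑ ∂μ ≤ A₁ * ∫⁻ x, ‖fderiv ℝ u x‖ₑ ∂μ)
    (hl2 : ∀ u : E → ℝ, ContDiff ℝ ∞ u → HasCompactSupport u →
      ∫⁻ x, ‖T u x‖ₑ ^ 2 ∂μ ≤ A₂ * ∫⁻ x, ‖fderiv ℝ u x‖ₑ ^ 2 ∂μ)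
    {u : E → ℝ} (hu : ContDiff ℝ ∞ u) (hcu : HasCompactSupport u) {l : ℝ≥0} (hl : 0 < l) :
    μ {x | (l : ℝ≥0∞) < ‖T u x‖ₑ} ≤
      ((l : ℝ≥0∞) / 4)⁻¹ * A₁ *
          (2 ^ finrank ℝ E * ∫⁻ x in {x | (l : ℝ≥0∞) / 2 ^ (finrank ℝ E + 1) <
              maximalFunction μ (fun w => ‖fderiv ℝ u w‖ₑ) x},
              maximalFunction μ (fun w => ‖fderiv ℝ u w‖ₑ) x ∂μ +
            ((2 ^ (2 * finrank ℝ E + 6) * l : ℝ≥0) : ℝ≥0∞) *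
              μ {x | (l : ℝ≥0∞) / 2 ^ (finrank ℝ E + 1) <
                maximalFunction μ (fun w => ‖fderiv ℝ u w‖ₑ) x}) +
        (((l : ℝ≥0∞) / 4) ^ 2)⁻¹ * A₂ *
          (2 ^ (2 * finrank ℝ E) * ∫⁻ x in {x | maximalFunction μ (fun w => ‖fderiv ℝ u w‖ₑ) x ≤ l},
              maximalFunction μ (fun w => ‖fderiv ℝ u w‖ₑ) x ^ 2 ∂μ +
            ((2 ^ (2 * finrank ℝ E + 6) * l : ℝ≥0) : ℝ≥0∞) ^ 2 *
              μ {x | (l : ℝ≥0∞) / 2 ^ (finrank ℝ E + 1) <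
                maximalFunction μ (fun w => ‖fderiv ℝ u w‖ₑ) x}) := by
  set n := finrank ℝ E with hn
  set M := maximalFunction μ (fun w => ‖fderiv ℝ u w‖ₑ) with hM
  set L : ℝ≥0 := 2 ^ (2 * n + 6) * l with hL
  set l' : ℝ≥0∞ := (l : ℝ≥0∞) / 2 ^ (n + 1) with hl'
  have hMm : Measurable M := measurable_maximalFunction μ _
  have hΩm : MeasurableSet {x | l' < M x} := measurableSet_lt measurable_const hMm
  have hEm : MeasurableSet {x | M x ≤ l} := measurableSet_le hMm measurable_const
  have hl0 : (l : ℝ≥0∞) ≠ 0 := by exact_mod_cast hl.ne'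
  have hl4 : (l : ℝ≥0∞) / 4 ≠ 0 := (ENNReal.div_pos hl0 (by norm_num)).ne'
  have hl4t : (l : ℝ≥0∞) / 4 ≠ ⊤ := ENNReal.div_ne_top ENNReal.coe_ne_top (by norm_num)
  have hlh : (l : ℝ≥0∞) / 2 ≠ 0 := (ENNReal.div_pos hl0 (by norm_num)).ne'
  have hlht : (l : ℝ≥0∞) / 2 ≠ ⊤ := ENNReal.div_ne_top ENNReal.coe_ne_top (by norm_num)
  have hu1 : ContDiff ℝ 1 u := hu.of_le (by exact_mod_cast le_top)
  -- the truncation radius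
  obtain ⟨ε₀, hε₀, htrunc⟩ := exists_smooth_lipschitz_truncation μ hu1 hcu hl
  refine ENNReal.le_of_forall_pos_le_add fun δ hδ _ => ?_
  -- the error term `(λ/2)⁻² A₂ ∫ ‖D(u - u_ε)‖²` is made `≤ δ`
  set c : ℝ≥0∞ := (((l : ℝ≥0∞) / 2) ^ 2)⁻¹ * A₂ with hc
  have hct : c ≠ ⊤ :=
    ENNReal.mul_ne_top (ENNReal.inv_ne_top.2 (pow_ne_zero 2 hlh)) ENNReal.coe_ne_top
  set δ' : ℝ≥0∞ := (δ : ℝ≥0∞) / c with hδ'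
  have hδ'0 : 0 < δ' := ENNReal.div_pos (by exact_mod_cast hδ.ne') hct
  obtain ⟨ε₁, hε₁, hconv⟩ := exists_lintegral_fderiv_sub_haarMollify_sq_le μ hu1 hcu hδ'0
  set ε := min ε₀ ε₁ with hεdef
  have hε : 0 < ε := lt_min hε₀ hε₁
  obtain ⟨g, b, hg, hgc, hb, hbc, hdec, hDg, hDb, hoff⟩ := htrunc ε hε (min_le_left _ _)
  have hconvε := hconv ε hε (min_le_right _ _)
  -- smoothness of the pieces
  have huε : ContDiff ℝ ∞ (haarMollify μ ε u) :=
    contDiff_haarMollify μ ε hu.continuous.locallyIntegrable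
  have huεc : HasCompactSupport (haarMollify μ ε u) := hasCompactSupport_haarMollify μ ε hcu
  -- `T u = T u_ε + T (u - u_ε)` and `T u_ε = T g + T b`
  have hsplit1 : ∀ x, T u x = T (haarMollify μ ε u) x + T (u - haarMollify μ ε u) x := fun x =>
    apply_eq_add_sub_of_add hadd hu hcu huε huεc x
  have hsplit2 : ∀ x, T (haarMollify μ ε u) x = T g x + T b x := fun x => by
    rw [hdec, hadd g b hg hgc hb hbc, Pi.add_apply]
  -- the three Chebyshev bounds
  have hB : μ {x | (l : ℝ≥0∞) / 4 < ‖T b x‖ₑ} ≤ ((l : ℝ≥0∞) / 4)⁻¹ * A₁ *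
      (2 ^ n * ∫⁻ x in {x | l' < M x}, M x ∂μ + (L : ℝ≥0∞) * μ {x | l' < M x}) := by
    refine (meas_lt_enorm_le_lintegral (hmeas b hb hbc) hl4 hl4t).trans ?_
    rw [mul_assoc]
    refine mul_le_mul_right ((hl1 b hb hbc).trans (mul_le_mul_right ?_ _)) _
    -- `∫ ‖Db‖ ≤ 2ⁿ ∫_{λ'<M} M + L μ{λ'<M}`
    have hpt : ∀ x, ‖fderiv ℝ b x‖ₑ ≤
        {x | l' < M x}.indicator (fun x => 2 ^ n * M x + (L : ℝ≥0∞)) x := by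
      intro x
      by_cases hx : l' < M x
      · rw [indicator_of_mem (show x ∈ {x | l' < M x} from hx)]
        exact hDb x
      · rw [indicator_of_notMem (show x ∉ {x | l' < M x} from hx), (hoff x hx).1, ← ofReal_norm,
          norm_zero, ENNReal.ofReal_zero]
    calc ∫⁻ x, ‖fderiv ℝ b x‖ₑ ∂μ
        ≤ ∫⁻ x, {x | l' < M x}.indicator (fun x => 2 ^ n * M x + (L : ℝ≥0∞)) x ∂μ :=
          lintegral_mono hpt
      _ = 2 ^ n * ∫⁻ x in {x | l' < M x}, M x ∂μ + (L : ℝ≥0∞) * μ {x | l' < M x} := by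
          rw [lintegral_indicator hΩm, lintegral_add_right _ measurable_const,
            lintegral_const_mul _ hMm, setLIntegral_const]
  have hG : μ {x | (l : ℝ≥0∞) / 4 < ‖T g x‖ₑ} ≤ (((l : ℝ≥0∞) / 4) ^ 2)⁻¹ * A₂ *
      (2 ^ (2 * n) * ∫⁻ x in {x | M x ≤ l}, M x ^ 2 ∂μ + (L : ℝ≥0∞) ^ 2 * μ {x | l' < M x}) := by
    refine (meas_lt_enorm_le_lintegral_sq (hmeas g hg hgc) hl4 hl4t).trans ?_
    rw [mul_assoc]
    refine mul_le_mul_right ((hl2 g hg hgc).trans (mul_le_mul_right ?_ _)) _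
    -- `∫ ‖Dg‖² ≤ 2²ⁿ ∫_{M≤λ} M² + L² μ{λ'<M}`
    have hpt : ∀ x, ‖fderiv ℝ g x‖ₑ ^ 2 ≤
        {x | M x ≤ l}.indicator (fun x => 2 ^ (2 * n) * M x ^ 2) x +
          {x | l' < M x}.indicator (fun _ => (L : ℝ≥0∞) ^ 2) x := by
      intro x
      by_cases hx : l' < M x
      · rw [indicator_of_mem (show x ∈ {x | l' < M x} from hx)]
        exact (pow_le_pow_left' (hDg x) 2).trans le_add_self
      · have h := hoff x hx
        rw [indicator_of_mem (show x ∈ {x | M x ≤ l} from h.2.2),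
          indicator_of_notMem (show x ∉ {x | l' < M x} from hx), add_zero]
        calc ‖fderiv ℝ g x‖ₑ ^ 2 ≤ (2 ^ n * M x) ^ 2 := pow_le_pow_left' h.2.1 2
          _ = 2 ^ (2 * n) * M x ^ 2 := by rw [mul_pow, ← pow_mul, mul_comm n 2]
    calc ∫⁻ x, ‖fderiv ℝ g x‖ₑ ^ 2 ∂μ
        ≤ ∫⁻ x, ({x | M x ≤ l}.indicator (fun x => 2 ^ (2 * n) * M x ^ 2) x +
            {x | l' < M x}.indicator (fun _ => (L : ℝ≥0∞) ^ 2) x) ∂μ := lintegral_mono hpt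
      _ = 2 ^ (2 * n) * ∫⁻ x in {x | M x ≤ l}, M x ^ 2 ∂μ + (L : ℝ≥0∞) ^ 2 * μ {x | l' < M x} := by
          rw [lintegral_add_left ((Measurable.const_mul (hMm.pow_const 2) _).indicator hEm),
            lintegral_indicator hEm, lintegral_indicator hΩm,
            lintegral_const_mul _ (hMm.pow_const 2),
            setLIntegral_const]
  have hR : μ {x | (l : ℝ≥0∞) / 2 < ‖T (u - haarMollify μ ε u) x‖ₑ} ≤ δ := by
    have hsm : ContDiff ℝ ∞ (u - haarMollify μ ε u) := hu.sub huε
    have hsc : HasCompactSupport (u - haarMollify μ ε u) := hcu.sub huεc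
    calc μ {x | (l : ℝ≥0∞) / 2 < ‖T (u - haarMollify μ ε u) x‖ₑ}
        ≤ (((l : ℝ≥0∞) / 2) ^ 2)⁻¹ * ∫⁻ x, ‖T (u - haarMollify μ ε u) x‖ₑ ^ 2 ∂μ :=
          meas_lt_enorm_le_lintegral_sq (hmeas _ hsm hsc) hlh hlht
      _ ≤ (((l : ℝ≥0∞) / 2) ^ 2)⁻¹ * (A₂ * ∫⁻ x, ‖fderiv ℝ (u - haarMollify μ ε u) x‖ₑ ^ 2 ∂μ) :=
          mul_le_mul_right (hl2 _ hsm hsc) _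
      _ = c * ∫⁻ x, ‖fderiv ℝ u x - fderiv ℝ (haarMollify μ ε u) x‖ₑ ^ 2 ∂μ := by
          rw [← mul_assoc, ← hc]
          congr 1
          refine lintegral_congr fun x => ?_
          rw [fderiv_sub ((hu1.differentiable one_ne_zero) x)
            (((huε.of_le (by exact_mod_cast le_top) : ContDiff ℝ 1 _).differentiable
              one_ne_zero) x)]
      _ ≤ c * δ' := mul_le_mul_right hconvε _
      _ ≤ δ := ENNReal.mul_div_le
  -- assemble
  calc μ {x | (l : ℝ≥0∞) < ‖T u x‖ₑ}
      ≤ μ ({x | (l : ℝ≥0∞) / 2 < ‖T (haarMollify μ ε u) x‖ₑ} ∪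
          {x | (l : ℝ≥0∞) / 2 < ‖T (u - haarMollify μ ε u) x‖ₑ}) := by
        refine measure_mono fun x hx => setOf_lt_enorm_add_subset _ _ _ ?_
        rw [mem_setOf_eq, ← hsplit1 x]; exact hx
    _ ≤ μ {x | (l : ℝ≥0∞) / 2 < ‖T (haarMollify μ ε u) x‖ₑ} +
          μ {x | (l : ℝ≥0∞) / 2 < ‖T (u - haarMollify μ ε u) x‖ₑ} := measure_union_le _ _
    _ ≤ μ ({x | (l : ℝ≥0∞) / 4 < ‖T g x‖ₑ} ∪ {x | (l : ℝ≥0∞) / 4 < ‖T b x‖ₑ}) + δ := by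
        refine add_le_add (measure_mono fun x hx => ?_) hR
        have h4 : (l : ℝ≥0∞) / 2 / 2 = (l : ℝ≥0∞) / 4 := by
          rw [div_eq_mul_inv, div_eq_mul_inv, div_eq_mul_inv, mul_assoc,
            ← ENNReal.mul_inv (Or.inl (by norm_num)) (Or.inl (by norm_num))]
          norm_num
        have hx' : (l : ℝ≥0∞) / 2 < ‖T g x + T b x‖ₑ := by
          rw [mem_setOf_eq, hsplit2 x] at hx; exact hx
        have h := setOf_lt_enorm_add_subset (T g) (T b) ((l : ℝ≥0∞) / 2) hx'
        rwa [h4] at h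
    _ ≤ μ {x | (l : ℝ≥0∞) / 4 < ‖T g x‖ₑ} + μ {x | (l : ℝ≥0∞) / 4 < ‖T b x‖ₑ} + δ :=
        add_le_add (measure_union_le _ _) le_rfl
    _ ≤ _ := by
        rw [add_comm (μ _) (μ _)]
        exact add_le_add (add_le_add hB hG) le_rfl

end Literature.Analysis.FunctionSpaces

namespace Literature.Analysis.FunctionSpaces

open Literature.Analysis.SingularIntegrals

/-! ### The abstract `λ`-integration -/

section LambdaIntegration

variable {α : Type*} [MeasurableSpace α] {μ : Measure α} [SFinite μ]

/-- `(ofReal t)⁻¹ ofReal(t^{p-1}) = ofReal(t^{p-2})` for `t > 0`. [folklore] -/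
theorem ofReal_inv_mul_ofReal_rpow {t : ℝ} (ht : 0 < t) (p : ℝ) :
    (ENNReal.ofReal t)⁻¹ * ENNReal.ofReal (t ^ (p - 1)) = ENNReal.ofReal (t ^ (p - 2)) := by
  rw [← ENNReal.ofReal_inv_of_pos ht, ← ENNReal.ofReal_mul (inv_nonneg.2 ht.le),
    ← Real.rpow_neg_one t, ← Real.rpow_add ht]
  congr 2; ring

/-- `(ofReal t)⁻² ofReal(t^{p-1}) = ofReal(t^{p-1-2})` for `t > 0`. [folklore] -/
theorem ofReal_sq_inv_mul_ofReal_rpow {t : ℝ} (ht : 0 < t) (p : ℝ) :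
    ((ENNReal.ofReal t) ^ 2)⁻¹ * ENNReal.ofReal (t ^ (p - 1)) =
      ENNReal.ofReal (t ^ (p - 1 - 2)) := by
  rw [← ENNReal.ofReal_pow ht.le, ← ENNReal.ofReal_inv_of_pos (by positivity),
    ← ENNReal.ofReal_mul (inv_nonneg.2 (by positivity)), ← Real.rpow_natCast,
    ← Real.rpow_neg ht.le, ← Real.rpow_add ht]
  congr 2; push_cast; ring

/-- **`λ`-integration.** If `f ≥ 0` satisfies, for every level `t > 0`,
`μ{t < f} ≤ B₁ t⁻¹ ∫_{t < c g} g + B₂ μ{t < c g} + B₃ t⁻² ∫_{g ≤ t} g²` with a measurable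
`g ≥ 0` and `c ≥ 1`, then for `1 < p < 2`:
`∫ fᵖ ≤ (p B₁ (p-1)⁻¹ cᵖ + B₂ cᵖ + p B₃ (2-p)⁻¹) ∫ gᵖ`.
[cite: Stein1971, Ch. I §4.3 (the two Tonelli computations)] -/
theorem lintegral_rpow_le_of_meas_lt_le {f g : α → ℝ} (hf0 : ∀ x, 0 ≤ f x)
    (hfm : AEMeasurable f μ) (hg : Measurable g) (hg0 : ∀ x, 0 ≤ g x) {c : ℝ} (hc : 1 ≤ c)
    {B₁ B₂ B₃ : ℝ≥0∞} {p : ℝ} (hp1 : 1 < p) (hp2 : p < 2)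
    (h : ∀ t : ℝ, 0 < t → μ {x | t < f x} ≤
      B₁ * (ENNReal.ofReal t)⁻¹ *
        ∫⁻ x, {x | t < c * g x}.indicator (fun x => ENNReal.ofReal (g x)) x ∂μ +
      B₂ * μ {x | t < c * g x} +
      B₃ * ((ENNReal.ofReal t) ^ 2)⁻¹ *
        ∫⁻ x, {x | g x ≤ t}.indicator (fun x => ENNReal.ofReal (g x ^ 2)) x ∂μ) :
    ∫⁻ x, ENNReal.ofReal (f x ^ p) ∂μ ≤
      (ENNReal.ofReal p * B₁ * ENNReal.ofReal (p - 1)⁻¹ * ENNReal.ofReal (c ^ p) +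
        B₂ * ENNReal.ofReal (c ^ p) + ENNReal.ofReal p * B₃ * ENNReal.ofReal (2 - p)⁻¹) *
      ∫⁻ x, ENNReal.ofReal (g x ^ p) ∂μ := by
  have hp0 : 0 < p := by linarith
  have hc0 : 0 < c := by linarith
  -- the scaled function `c g`
  have hcg : Measurable fun x => c * g x := hg.const_mul c
  have hcg0 : ∀ x, 0 ≤ c * g x := fun x => mul_nonneg hc0.le (hg0 x)
  have hcgp : ∫⁻ x, ENNReal.ofReal ((c * g x) ^ p) ∂μ =
      ENNReal.ofReal (c ^ p) * ∫⁻ x, ENNReal.ofReal (g x ^ p) ∂μ := by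
    rw [← lintegral_const_mul _ (hg.pow_const _).ennreal_ofReal]
    refine lintegral_congr fun x => ?_
    rw [Real.mul_rpow hc0.le (hg0 x), ENNReal.ofReal_mul (by positivity)]
  -- the three `t`-integrands
  set Φ₁ : ℝ → ℝ≥0∞ := fun t =>
    ∫⁻ x, {x | t < c * g x}.indicator (fun x => ENNReal.ofReal (g x)) x ∂μ with hΦ₁
  set Φ₂ : ℝ → ℝ≥0∞ := fun t => μ {x | t < c * g x} with hΦ₂
  set Φ₃ : ℝ → ℝ≥0∞ := fun t =>
    ∫⁻ x, {x | g x ≤ t}.indicator (fun x => ENNReal.ofReal (g x ^ 2)) x ∂μ with hΦ₃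
  have hΦ₁m : Measurable Φ₁ := by
    refine Antitone.measurable fun s t hst => lintegral_mono fun x => ?_
    exact indicator_le_indicator_apply_of_subset
      (fun x (hx : t < c * g x) => show s < c * g x from lt_of_le_of_lt hst hx) zero_le
  have hΦ₂m : Measurable Φ₂ := by
    refine Antitone.measurable fun s t hst => measure_mono fun x (hx : t < c * g x) => ?_
    exact show s < c * g x from lt_of_le_of_lt hst hx
  have hΦ₃m : Measurable Φ₃ := by
    refine Monotone.measurable fun s t hst => lintegral_mono fun x => ?_
    exact indicator_le_indicator_apply_of_subset
      (fun x (hx : g x ≤ s) => show g x ≤ t from hx.trans hst) zero_le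
  -- (K1): first Tonelli computation, after `g ≤ c g` inside the indicator
  have hK1 : ∫⁻ t in Ioi (0 : ℝ), ENNReal.ofReal (t ^ (p - 2)) * Φ₁ t ≤
      ENNReal.ofReal (p - 1)⁻¹ * (ENNReal.ofReal (c ^ p) * ∫⁻ x, ENNReal.ofReal (g x ^ p) ∂μ) := by
    rw [← hcgp, ← lintegral_rpow_mul_lintegral_indicator_lt hcg hcg0 hp1]
    refine lintegral_mono fun t => mul_le_mul_right (lintegral_mono fun x => ?_) _
    refine indicator_le_indicator' fun _ => ENNReal.ofReal_le_ofReal ?_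
    exact le_mul_of_one_le_left (hg0 x) hc
  -- (K2): layer cake for `c g`
  have hK2 : ENNReal.ofReal p * ∫⁻ t in Ioi (0 : ℝ), Φ₂ t * ENNReal.ofReal (t ^ (p - 1)) =
      ENNReal.ofReal (c ^ p) * ∫⁻ x, ENNReal.ofReal (g x ^ p) ∂μ := by
    rw [← hcgp, lintegral_rpow_eq_lintegral_meas_lt_mul μ (Eventually.of_forall hcg0)
      hcg.aemeasurable hp0]
  -- (K3): second Tonelli computation with `r = 2`
  have hK3 : ∫⁻ t in Ioi (0 : ℝ), ENNReal.ofReal (t ^ (p - 1 - 2)) * Φ₃ t =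
      ENNReal.ofReal (2 - p)⁻¹ * ∫⁻ x, ENNReal.ofReal (g x ^ p) ∂μ := by
    have h := lintegral_rpow_mul_lintegral_indicator_le (μ := μ) hg hg0 hp0 hp2
    simp only [Real.rpow_two] at h
    simpa [hΦ₃] using h
  -- layer cake for `f` and the pointwise bound
  rw [lintegral_rpow_eq_lintegral_meas_lt_mul μ (Eventually.of_forall hf0) hfm hp0]
  have hpt : ∀ t ∈ Ioi (0 : ℝ), μ {x | t < f x} * ENNReal.ofReal (t ^ (p - 1)) ≤
      B₁ * (ENNReal.ofReal (t ^ (p - 2)) * Φ₁ t) + B₂ * (Φ₂ t * ENNReal.ofReal (t ^ (p - 1))) +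
        B₃ * (ENNReal.ofReal (t ^ (p - 1 - 2)) * Φ₃ t) := by
    intro t ht
    refine (mul_le_mul_left (h t ht) _).trans (le_of_eq ?_)
    rw [← ofReal_inv_mul_ofReal_rpow ht p, ← ofReal_sq_inv_mul_ofReal_rpow ht p]
    simp only [hΦ₁, hΦ₂, hΦ₃]
    ring
  -- measurability of the three `t`-integrands, and pulling out constants
  have hr2 : Measurable fun t : ℝ => ENNReal.ofReal (t ^ (p - 2)) :=
    (measurable_id.pow_const _).ennreal_ofReal
  have hr1 : Measurable fun t : ℝ => ENNReal.ofReal (t ^ (p - 1)) :=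
    (measurable_id.pow_const _).ennreal_ofReal
  have hr3 : Measurable fun t : ℝ => ENNReal.ofReal (t ^ (p - 1 - 2)) :=
    (measurable_id.pow_const _).ennreal_ofReal
  have hn1 : Measurable fun t : ℝ => ENNReal.ofReal (t ^ (p - 2)) * Φ₁ t := hr2.mul hΦ₁m
  have hn2 : Measurable fun t : ℝ => Φ₂ t * ENNReal.ofReal (t ^ (p - 1)) := hΦ₂m.mul hr1
  have hn3 : Measurable fun t : ℝ => ENNReal.ofReal (t ^ (p - 1 - 2)) * Φ₃ t := hr3.mul hΦ₃m
  have hm1 : Measurable fun t : ℝ => B₁ * (ENNReal.ofReal (t ^ (p - 2)) * Φ₁ t) :=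
    hn1.const_mul _
  have hm2 : Measurable fun t : ℝ => B₂ * (Φ₂ t * ENNReal.ofReal (t ^ (p - 1))) :=
    hn2.const_mul _
  have hm12 : Measurable fun t : ℝ => B₁ * (ENNReal.ofReal (t ^ (p - 2)) * Φ₁ t) +
      B₂ * (Φ₂ t * ENNReal.ofReal (t ^ (p - 1))) := hm1.add hm2
  have e1 : ∫⁻ t in Ioi (0 : ℝ), B₁ * (ENNReal.ofReal (t ^ (p - 2)) * Φ₁ t) =
      B₁ * ∫⁻ t in Ioi (0 : ℝ), ENNReal.ofReal (t ^ (p - 2)) * Φ₁ t := lintegral_const_mul _ hn1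
  have e2 : ∫⁻ t in Ioi (0 : ℝ), B₂ * (Φ₂ t * ENNReal.ofReal (t ^ (p - 1))) =
      B₂ * ∫⁻ t in Ioi (0 : ℝ), Φ₂ t * ENNReal.ofReal (t ^ (p - 1)) := lintegral_const_mul _ hn2
  have e3 : ∫⁻ t in Ioi (0 : ℝ), B₃ * (ENNReal.ofReal (t ^ (p - 1 - 2)) * Φ₃ t) =
      B₃ * ∫⁻ t in Ioi (0 : ℝ), ENNReal.ofReal (t ^ (p - 1 - 2)) * Φ₃ t := lintegral_const_mul _ hn3
  calc ENNReal.ofReal p * ∫⁻ t in Ioi 0, μ {x | t < f x} * ENNReal.ofReal (t ^ (p - 1))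
      ≤ ENNReal.ofReal p * ∫⁻ t in Ioi 0, (B₁ * (ENNReal.ofReal (t ^ (p - 2)) * Φ₁ t) +
          B₂ * (Φ₂ t * ENNReal.ofReal (t ^ (p - 1))) +
          B₃ * (ENNReal.ofReal (t ^ (p - 1 - 2)) * Φ₃ t)) :=
        mul_le_mul_right (setLIntegral_mono' measurableSet_Ioi hpt) _
    _ = ENNReal.ofReal p * (B₁ * ∫⁻ t in Ioi 0, ENNReal.ofReal (t ^ (p - 2)) * Φ₁ t) +
          B₂ * (ENNReal.ofReal p * ∫⁻ t in Ioi 0, Φ₂ t * ENNReal.ofReal (t ^ (p - 1))) +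
          ENNReal.ofReal p * (B₃ * ∫⁻ t in Ioi 0, ENNReal.ofReal (t ^ (p - 1 - 2)) * Φ₃ t) := by
        rw [lintegral_add_left hm12, lintegral_add_left hm1, e1, e2, e3]
        ring
    _ ≤ ENNReal.ofReal p * (B₁ * (ENNReal.ofReal (p - 1)⁻¹ *
            (ENNReal.ofReal (c ^ p) * ∫⁻ x, ENNReal.ofReal (g x ^ p) ∂μ))) +
          B₂ * (ENNReal.ofReal (c ^ p) * ∫⁻ x, ENNReal.ofReal (g x ^ p) ∂μ) +
          ENNReal.ofReal p *
            (B₃ * (ENNReal.ofReal (2 - p)⁻¹ * ∫⁻ x, ENNReal.ofReal (g x ^ p) ∂μ)) := by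
        rw [hK2, hK3]
        gcongr
    _ = _ := by ring

end LambdaIntegration

/-! ### Gradient-dominated operators: `∫ ‖Tu‖ᵖ ≲ ∫ ‖Du‖ᵖ` -/

section Operator

universe u

variable {E : Type u} [NormedAddCommGroup E] [NormedSpace ℝ E] [FiniteDimensional ℝ E]
  [MeasurableSpace E] [BorelSpace E] {μ : Measure E} [μ.IsAddHaarMeasure]
  {G : Type*} [NormedAddCommGroup G]

/-- `(a/4)⁻¹ = 4 a⁻¹` in `ℝ≥0∞`. [folklore] -/
theorem inv_div_four (a : ℝ≥0∞) : (a / 4)⁻¹ = 4 * a⁻¹ := by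
  rw [ENNReal.inv_div (Or.inl (by norm_num)) (Or.inl (by norm_num)), div_eq_mul_inv]

/-- `((a/4)²)⁻¹ = 16 (a²)⁻¹` in `ℝ≥0∞`. [folklore] -/
theorem inv_div_four_sq (a : ℝ≥0∞) : ((a / 4) ^ 2)⁻¹ = 16 * (a ^ 2)⁻¹ := by
  rw [div_eq_mul_inv, mul_pow, ENNReal.mul_inv (Or.inr (by simp)) (Or.inr (by simp)),
    ← ENNReal.inv_pow, inv_inv, mul_comm]
  norm_num

/-- **Gradient-dominated operators are bounded in `Ẇ^{1,p}` for `1 < p < 2`:** there is a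
finite `K = K(n, p, A₁, A₂)` with `∫ ‖Tu‖ᵖ dμ ≤ K ∫ ‖Du‖ᵖ dμ` for every real `u ∈ C^∞_c(E)`.
[cite: Badr2009, Thm 1.4 and Cor. 5.9 (real interpolation of Ẇ¹_p), operator form;
DeVoreScherer1979 for ℝⁿ] -/
theorem exists_lintegral_rpow_le_of_gradientBounds {T : (E → ℝ) → E → G} {A₁ A₂ : ℝ≥0}
    (hadd : ∀ u v : E → ℝ, ContDiff ℝ ∞ u → HasCompactSupport u → ContDiff ℝ ∞ v →
      HasCompactSupport v → T (u + v) = T u + T v)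
    (hmeas : ∀ u : E → ℝ, ContDiff ℝ ∞ u → HasCompactSupport u → AEStronglyMeasurable (T u) μ)
    (hl1 : ∀ u : E → ℝ, ContDiff ℝ ∞ u → HasCompactSupport u →
      ∫⁻ x, ‖T u x‖ₑ ∂μ ≤ A₁ * ∫⁻ x, ‖fderiv ℝ u x‖ₑ ∂μ)
    (hl2 : ∀ u : E → ℝ, ContDiff ℝ ∞ u → HasCompactSupport u →
      ∫⁻ x, ‖T u x‖ₑ ^ 2 ∂μ ≤ A₂ * ∫⁻ x, ‖fderiv ℝ u x‖ₑ ^ 2 ∂μ)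
    {p : ℝ} (hp1 : 1 < p) (hp2 : p < 2) :
    ∃ K : ℝ≥0∞, K ≠ ⊤ ∧ ∀ u : E → ℝ, ContDiff ℝ ∞ u → HasCompactSupport u →
      ∫⁻ x, ‖T u x‖ₑ ^ p ∂μ ≤ K * ∫⁻ x, ‖fderiv ℝ u x‖ₑ ^ p ∂μ := by
  set n := finrank ℝ E with hn
  have hp0 : 0 < p := by linarith
  -- the constants
  set c : ℝ := 2 ^ (n + 1) with hc
  have hc1 : 1 ≤ c := one_le_pow₀ one_le_two
  have hc0 : 0 < c := by positivity
  set B₁ : ℝ≥0∞ := 4 * A₁ * 2 ^ n with hB₁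
  set B₂ : ℝ≥0∞ := 4 * A₁ * 2 ^ (2 * n + 6) + 16 * A₂ * 2 ^ (4 * n + 12) with hB₂
  set B₃ : ℝ≥0∞ := 16 * A₂ * 2 ^ (2 * n) with hB₃
  set K₀ : ℝ≥0∞ := ENNReal.ofReal p * B₁ * ENNReal.ofReal (p - 1)⁻¹ * ENNReal.ofReal (c ^ p) +
    B₂ * ENNReal.ofReal (c ^ p) + ENNReal.ofReal p * B₃ * ENNReal.ofReal (2 - p)⁻¹ with hK₀
  set CM : ℝ≥0∞ := ENNReal.ofReal p * (2 * 5 ^ n) *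
    ((2 : ℝ≥0∞) ^ (p - 1) / ENNReal.ofReal (p - 1)) with hCM
  have hB₁t : B₁ ≠ ⊤ := by simp [hB₁, ENNReal.mul_ne_top]
  have hB₂t : B₂ ≠ ⊤ := by simp [hB₂, ENNReal.mul_ne_top]
  have hB₃t : B₃ ≠ ⊤ := by simp [hB₃, ENNReal.mul_ne_top]
  have hK₀t : K₀ ≠ ⊤ := by
    simp only [hK₀]
    refine ENNReal.add_ne_top.2 ⟨ENNReal.add_ne_top.2 ⟨?_, ?_⟩, ?_⟩ <;>
      apply_rules [ENNReal.mul_ne_top, ENNReal.ofReal_ne_top]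
  have hCMt : CM ≠ ⊤ := by
    simp only [hCM]
    refine ENNReal.mul_ne_top (ENNReal.mul_ne_top ENNReal.ofReal_ne_top
      (ENNReal.mul_ne_top (by norm_num) (ENNReal.pow_ne_top (by norm_num)))) ?_
    refine ENNReal.div_ne_top (ENNReal.rpow_ne_top_of_nonneg (by linarith) (by simp)) ?_
    exact (ENNReal.ofReal_pos.2 (by linarith)).ne'
  refine ⟨K₀ * CM, ENNReal.mul_ne_top hK₀t hCMt, fun u hu hcu => ?_⟩
  -- the size, its maximal function (finite everywhere) and the real version `g`
  have hu1 : ContDiff ℝ 1 u := hu.of_le (by exact_mod_cast le_top)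
  have hDc : Continuous (fderiv ℝ u) := hu1.continuous_fderiv one_ne_zero
  set M := maximalFunction μ (fun w => ‖fderiv ℝ u w‖ₑ) with hM
  have hMm : Measurable M := measurable_maximalFunction μ _
  obtain ⟨S, hS⟩ := (hDc.norm).bddAbove_range_of_hasCompactSupport (hcu.fderiv ℝ).norm
  have hMt : ∀ x, M x ≠ ⊤ := fun x => by
    refine ne_top_of_le_ne_top ENNReal.ofReal_ne_top
      (maximalFunction_le_of_ae_le μ (c := ENNReal.ofReal S) (Eventually.of_forall fun y => ?_) x)
    rw [← ofReal_norm]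
    exact ENNReal.ofReal_le_ofReal (hS (mem_range_self y))
  set g : E → ℝ := fun x => (M x).toReal with hg
  have hgm : Measurable g := hMm.ennreal_toReal
  have hg0 : ∀ x, 0 ≤ g x := fun x => ENNReal.toReal_nonneg
  have hMg : ∀ x, M x = ENNReal.ofReal (g x) := fun x => (ENNReal.ofReal_toReal (hMt x)).symm
  -- the real function `f = ‖Tu‖`
  set f : E → ℝ := fun x => ‖T u x‖ with hf
  have hfm : AEMeasurable f μ := (hmeas u hu hcu).norm.aemeasurable
  have hf0 : ∀ x, 0 ≤ f x := fun x => norm_nonneg _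
  -- the distribution-function inequality in the form of the `λ`-integration lemma
  have hdist : ∀ t : ℝ, 0 < t → μ {x | t < f x} ≤
      B₁ * (ENNReal.ofReal t)⁻¹ *
          ∫⁻ x, {x | t < c * g x}.indicator (fun x => ENNReal.ofReal (g x)) x ∂μ +
        B₂ * μ {x | t < c * g x} +
        B₃ * ((ENNReal.ofReal t) ^ 2)⁻¹ *
          ∫⁻ x, {x | g x ≤ t}.indicator (fun x => ENNReal.ofReal (g x ^ 2)) x ∂μ := by
    intro t ht
    have htl : 0 < t.toNNReal := Real.toNNReal_pos.2 ht
    have h := meas_lt_enorm_le_of_gradientBounds hadd hmeas hl1 hl2 hu hcu htl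
    -- identify the level set of `‖Tu‖`
    have hset0 : {x | ((t.toNNReal : ℝ≥0) : ℝ≥0∞) < ‖T u x‖ₑ} = {x | t < f x} := by
      ext x
      simp only [mem_setOf_eq, hf, ← ofReal_norm]
      exact ENNReal.ofReal_lt_ofReal_iff_of_nonneg ht.le
    -- identify the sets and integrands built from `M`
    have hl : ((t.toNNReal : ℝ≥0) : ℝ≥0∞) = ENNReal.ofReal t := rfl
    have hsetΩ : {x | ((t.toNNReal : ℝ≥0) : ℝ≥0∞) / 2 ^ (n + 1) < M x} = {x | t < c * g x} := by
      ext x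
      simp only [mem_setOf_eq, hMg, hl]
      rw [show (2 : ℝ≥0∞) ^ (n + 1) = ENNReal.ofReal c by
          rw [hc, ENNReal.ofReal_pow zero_le_two, ENNReal.ofReal_ofNat],
        ← ENNReal.ofReal_div_of_pos hc0, ENNReal.ofReal_lt_ofReal_iff_of_nonneg (by positivity),
        div_lt_iff₀ hc0, mul_comm]
    have hsetE : {x | M x ≤ ((t.toNNReal : ℝ≥0) : ℝ≥0∞)} = {x | g x ≤ t} := by
      ext x
      simp only [mem_setOf_eq, hMg, hl]
      exact ENNReal.ofReal_le_ofReal_iff ht.le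
    have hint1 : ∫⁻ x in {x | t < c * g x}, M x ∂μ =
        ∫⁻ x, {x | t < c * g x}.indicator (fun x => ENNReal.ofReal (g x)) x ∂μ := by
      rw [← lintegral_indicator (measurableSet_lt measurable_const (hgm.const_mul c))]
      refine lintegral_congr fun x => ?_
      simp only [indicator_apply, mem_setOf_eq, hMg]
    have hint3 : ∫⁻ x in {x | g x ≤ t}, M x ^ 2 ∂μ =
        ∫⁻ x, {x | g x ≤ t}.indicator (fun x => ENNReal.ofReal (g x ^ 2)) x ∂μ := by
      rw [← lintegral_indicator (measurableSet_le hgm measurable_const)]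
      refine lintegral_congr fun x => ?_
      simp only [indicator_apply, mem_setOf_eq, hMg, ← ENNReal.ofReal_pow (hg0 _)]
    -- the `L`-terms lose their `t`
    have hl0 : ENNReal.ofReal t ≠ 0 := (ENNReal.ofReal_pos.2 ht).ne'
    have hL1 : (ENNReal.ofReal t / 4)⁻¹ * ((2 ^ (2 * n + 6) * t.toNNReal : ℝ≥0) : ℝ≥0∞) =
        4 * 2 ^ (2 * n + 6) := by
      push_cast
      rw [hl, inv_div_four, show (4 : ℝ≥0∞) * (ENNReal.ofReal t)⁻¹ * (2 ^ (2 * n + 6) *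
          ENNReal.ofReal t) = 4 * 2 ^ (2 * n + 6) * ((ENNReal.ofReal t)⁻¹ * ENNReal.ofReal t)
          by ring,
        ENNReal.inv_mul_cancel hl0 ENNReal.ofReal_ne_top, mul_one]
    have hL2 : ((ENNReal.ofReal t / 4) ^ 2)⁻¹ * ((2 ^ (2 * n + 6) * t.toNNReal : ℝ≥0) : ℝ≥0∞) ^ 2 =
        16 * 2 ^ (4 * n + 12) := by
      push_cast
      rw [hl, inv_div_four_sq, show (16 : ℝ≥0∞) * (ENNReal.ofReal t ^ 2)⁻¹ *
          (2 ^ (2 * n + 6) * ENNReal.ofReal t) ^ 2 = 16 * (2 ^ (2 * n + 6)) ^ 2 *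
          ((ENNReal.ofReal t ^ 2)⁻¹ * ENNReal.ofReal t ^ 2) by ring,
        ENNReal.inv_mul_cancel (pow_ne_zero 2 hl0) (ENNReal.pow_ne_top ENNReal.ofReal_ne_top),
        mul_one, ← pow_mul]
      ring_nf
    rw [hset0, hsetΩ, hsetE, hint1, hint3] at h
    refine h.trans (le_of_eq ?_)
    set Φ₁ := ∫⁻ x, {x | t < c * g x}.indicator (fun x => ENNReal.ofReal (g x)) x ∂μ
    set Φ₂ := μ {x | t < c * g x}
    set Φ₃ := ∫⁻ x, {x | g x ≤ t}.indicator (fun x => ENNReal.ofReal (g x ^ 2)) x ∂μ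
    set L : ℝ≥0∞ := ((2 ^ (2 * n + 6) * t.toNNReal : ℝ≥0) : ℝ≥0∞)
    set il := (ENNReal.ofReal t / 4)⁻¹
    set il2 := ((ENNReal.ofReal t / 4) ^ 2)⁻¹
    calc il * A₁ * (2 ^ n * Φ₁ + L * Φ₂) + il2 * A₂ * (2 ^ (2 * n) * Φ₃ + L ^ 2 * Φ₂)
        = A₁ * 2 ^ n * il * Φ₁ + A₁ * (il * L) * Φ₂ + A₂ * 2 ^ (2 * n) * il2 * Φ₃ +
            A₂ * (il2 * L ^ 2) * Φ₂ := by ring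
      _ = A₁ * 2 ^ n * (4 * (ENNReal.ofReal t)⁻¹) * Φ₁ + A₁ * (4 * 2 ^ (2 * n + 6)) * Φ₂ +
            A₂ * 2 ^ (2 * n) * (16 * (ENNReal.ofReal t ^ 2)⁻¹) * Φ₃ +
            A₂ * (16 * 2 ^ (4 * n + 12)) * Φ₂ := by
          rw [hL1, hL2]
          simp only [il, il2, inv_div_four, inv_div_four_sq]
      _ = _ := by simp only [hB₁, hB₂, hB₃]; ring
  -- the `λ`-integration
  have hmain := lintegral_rpow_le_of_meas_lt_le hf0 hfm hgm hg0 hc1 hp1 hp2 hdist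
  -- back to `ℝ≥0∞`-powers
  have hlhs : ∫⁻ x, ‖T u x‖ₑ ^ p ∂μ = ∫⁻ x, ENNReal.ofReal (f x ^ p) ∂μ := by
    refine lintegral_congr fun x => ?_
    simp only [hf]
    rw [← ENNReal.ofReal_rpow_of_nonneg (norm_nonneg _) hp0.le, ofReal_norm]
  have hrhs : ∫⁻ x, ENNReal.ofReal (g x ^ p) ∂μ = ∫⁻ x, M x ^ p ∂μ := by
    refine lintegral_congr fun x => ?_
    rw [← ENNReal.ofReal_rpow_of_nonneg (hg0 x) hp0.le, ← hMg]
  have hHL : ∫⁻ x, M x ^ p ∂μ ≤ CM * ∫⁻ x, ‖fderiv ℝ u x‖ₑ ^ p ∂μ :=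
    lintegral_maximalFunction_rpow_le μ hDc.measurable.enorm.aemeasurable hp1
  calc ∫⁻ x, ‖T u x‖ₑ ^ p ∂μ = ∫⁻ x, ENNReal.ofReal (f x ^ p) ∂μ := hlhs
    _ ≤ K₀ * ∫⁻ x, ENNReal.ofReal (g x ^ p) ∂μ := hmain
    _ ≤ K₀ * (CM * ∫⁻ x, ‖fderiv ℝ u x‖ₑ ^ p ∂μ) := by rw [hrhs]; exact mul_le_mul_right hHL _
    _ = K₀ * CM * ∫⁻ x, ‖fderiv ℝ u x‖ₑ ^ p ∂μ := (mul_assoc _ _ _).symm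

end Operator

end Literature.Analysis.FunctionSpaces

end
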